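import Summits.AtomisticToContinuum.HydrodynamicLimit.Theorems.InformationPercolationEnginePercolationClosesChaosDockingTarget
import Summits.AtomisticToContinuum.HydrodynamicLimit.Theorems.InformationPercolationEnginePercolationClosesChaosDockingTriples
import HarnessLib

/-!
# Docking S7 of the line `equilibrium-forecast-chain-rule` (crux `InformationPercolationEngine.PercolationClosesChaos`,
stmt-AtomisticToContinuum-15178) — piece B: per-collision replacement and the frozen main term of a step

Support file (`--supports stmt-AtomisticToContinuum-15178`) of the registered stub
`stub_docking : KineticCellChaosLG → NoMesoscopicOscillation → LocalCountUI → ContactChaos` (worker S7 of lead c2).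
Inside a kinetic step `k` (window `stepWindow k = (kΔ, (k+1)Δ]`, `Δ = cℓ_N`) the target's collision summand
`dockSummand = χ(s, x_i) [Ψ(mark) A_r(s, x_i) − B^Ψ_r(s, x_i)]` of a collision triple `e = (s, i, j)` is replaced by its
value FROZEN at the step start and at the centre of the start cell `q = startCell i` of its first member:

* `dockMain … k z e = χ(kΔ, centre q) [Ψ(mark) A_r(kΔ, centre q) − B^Ψ_r(kΔ, centre q)]`;
* `stepPath c σ N Φ k z i = ∫_{kΔ}^{(k+1)Δ} ‖v_i(u)‖ du`, the in-step path length of sphere `i`, which bounds its in-step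
  displacement (`HardSphereFlow.euclidDist_flow_le_integral_norm_vel_of_mem_Icc`), whence
  `euclidDist_cellCentre_startCell_le`: `dist(x_i(s), centre q) ≤ stepPath + (√3/2) Δ`;
* `abs_dockSummand_sub_dockMain_le` (registered helper): given sup / joint-Lipschitz bounds of the two mollified pair fields
  `targetPm 1`, `targetPm Ψ` (abstract constants; on a good orbit they are `abs_poolPairField_le` / `abs_poolPairField_sub_le`)
  and a sup bound `Cχ` and a uniform-continuity modulus `(ρ, ϖ)` of `χ` on `[0, S] × 𝕋³`, the replacement error of a triple
  of step `k` is `≤ α + β · stepPath`, `α = O(Δ) + ρ · C_P`, `β` a constant (far-displaced first members are charged to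
  their path length: `𝟙{stepPath > ϖ/2} ≤ (2/ϖ) stepPath`);
* `abs_dockSummand_le`, `abs_dockMain_le`: the crude bounds `Cχ · (CΨ S₁ + S_Ψ)`;
* `sum_dockMain_eq`: the frozen terms of a step regroup by start cell into
  `(n̄c) Σ_q χ(kΔ, centre q) Σ_{q'} [A_r(kΔ, centre q) collPair Ψ (q,q') − B^Ψ_r(kΔ, centre q) collPair 1 (q,q')]`;
* `abs_stepMain_le`: that cell sum is bounded by `Cχ ×` the integrand of `NoMesoscopicOscillation` (i) (with `Ξ := Ψ`)
  plus `Cχ S₁ Σ_q Σ_{q'} collPair 1 · |relDefect Ψ|` (the cross-ratio defect the kinetic-cell chaos controls).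

Elementary bookkeeping on the good set (CIP 1994 §4.2; GST 2013 Prop. 4.1.1).
-/

noncomputable section

open MeasureTheory Set Filter Topology
open scoped ENNReal BigOperators Classical
open Literature.Analysis.FluidPDE Literature.MathematicalPhysics.KineticTheory
open Literature.MathematicalPhysics.KineticTheory.VelocityBlindPlacement

namespace Summit.AtomisticToContinuum.HydrodynamicLimit.Theorems.EquilibriumForecastLine

/-! ## The in-step path length and the frozen main term -/

/-- IN-STEP PATH LENGTH of sphere `i` over step `k`: `∫_{kΔ}^{(k+1)Δ} ‖v_i(u)‖ du`. -/
def stepPath (c σ : ℝ) (N : ℕ) (Φ : Flow σ N) (k : ℕ) (z : Phase N) (i : Fin (N + 1)) : ℝ :=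
  ∫ u in ((k : ℝ) * stepLen c σ N)..(((k : ℝ) + 1) * stepLen c σ N), ‖(Φ.flow u z i).2‖

/-- FROZEN MAIN TERM of a collision triple `e = (s, i, j)` of step `k`: the target's summand with the localiser and the
two mollified pair fields read at the step start `kΔ` and at the centre of the start cell of `i` (the mark stays exact). -/
def dockMain (χ : ℝ × T3 → ℝ) (Ψ : V3 × V3 × V3 → ℝ) (r τ c σ : ℝ) (N : ℕ) (Φ : Flow σ N) (k : ℕ) (z : Phase N)
    (e : ℝ × Fin (N + 1) × Fin (N + 1)) : ℝ :=
  χ ((k : ℝ) * stepLen c σ N, cellCentre c σ N (startCell c σ N Φ k z e.2.1)) *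
    (Ψ (markOf N (hsDiameter σ N) (Φ.flow e.1 z) e.2.1 e.2.2) *
        targetPm (fun _ => 1) r τ σ N Φ z ((k : ℝ) * stepLen c σ N) (cellCentre c σ N (startCell c σ N Φ k z e.2.1)) -
      targetPm Ψ r τ σ N Φ z ((k : ℝ) * stepLen c σ N) (cellCentre c σ N (startCell c σ N Φ k z e.2.1)))

/-- The in-step path length is nonnegative (`0 ≤ Δ`). [folklore] -/
theorem stepPath_nonneg {c σ : ℝ} {N : ℕ} (hΔ : 0 ≤ stepLen c σ N) (Φ : Flow σ N) (k : ℕ) (z : Phase N)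
    (i : Fin (N + 1)) : 0 ≤ stepPath c σ N Φ k z i := by
  unfold stepPath
  exact Φ.integral_norm_vel_flow_nonneg z i (by nlinarith)

/-! ## Geometry of a collision triple of a step -/

section Triple

variable {σ : ℝ} {N : ℕ} (Φ : Flow σ N) {z : Phase N}

/-- The time of a triple of step `k` lies in the step window: `kΔ < s ≤ (k+1)Δ`. [folklore] -/
theorem time_mem_of_mem_collTriples (hz : z ∈ Φ.good) {c : ℝ} {k : ℕ} {e : ℝ × Fin (N + 1) × Fin (N + 1)}
    (he : e ∈ collTriples Φ (stepWindow c σ N k) z) :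
    (k : ℝ) * stepLen c σ N < e.1 ∧ e.1 ≤ ((k : ℝ) + 1) * stepLen c σ N :=
  ((mem_collTriples Φ hz (stepWindow_subset_Icc c σ N k)).1 he).1

/-- The time offset of a triple of step `k` from the step start is at most `Δ`. [folklore] -/
theorem abs_time_sub_le_of_mem_collTriples (hz : z ∈ Φ.good) {c : ℝ} {k : ℕ} {e : ℝ × Fin (N + 1) × Fin (N + 1)}
    (he : e ∈ collTriples Φ (stepWindow c σ N k) z) :
    |e.1 - (k : ℝ) * stepLen c σ N| ≤ stepLen c σ N := by
  obtain ⟨h1, h2⟩ := time_mem_of_mem_collTriples Φ hz he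
  rw [abs_of_pos (sub_pos.2 h1)]
  linarith

/-- **In-step displacement against the path length, read at the start-cell centre**: for a triple `(s, i, j)` of step
`k`, `dist(x_i(s), centre (startCell i)) ≤ stepPath i + (√3/2) Δ` (minimal-image distance). [folklore] -/
theorem euclidDist_cellCentre_startCell_le (hz : z ∈ Φ.good) {c : ℝ} (hc : 0 < c) (hσ : 0 < σ) {k : ℕ}
    {e : ℝ × Fin (N + 1) × Fin (N + 1)} (he : e ∈ collTriples Φ (stepWindow c σ N k) z) :
    Torus.euclidDist (Φ.flow e.1 z e.2.1).1 (cellCentre c σ N (startCell c σ N Φ k z e.2.1)) ≤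
      stepPath c σ N Φ k z e.2.1 + Real.sqrt 3 / 2 * stepLen c σ N := by
  obtain ⟨h1, h2⟩ := time_mem_of_mem_collTriples Φ hz he
  have hh : 0 < c * meanFreePath σ N := mul_pos hc (meanFreePath_pos hσ N)
  have hdisp : Torus.euclidDist (Φ.flow e.1 z e.2.1).1 (Φ.flow ((k : ℝ) * stepLen c σ N) z e.2.1).1 ≤
      stepPath c σ N Φ k z e.2.1 :=
    Φ.euclidDist_flow_le_integral_norm_vel_of_mem_Icc hz e.2.1 ⟨h1.le, h2⟩
  have hctr := euclidDist_cellCentre_le hh (Φ.flow ((k : ℝ) * stepLen c σ N) z e.2.1).1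
  exact (torus_euclidDist_triangle _ _ _).trans (add_le_add hdisp hctr)

end Triple

/-! ## The replacement inequality -/

/-- Pure algebra of the replacement: `χ₁ψP − χ₁Q − χ₀(ψP₀ − Q₀) = χ₁ψ(P − P₀) − χ₁(Q − Q₀) + (χ₁ − χ₀)(ψP₀ − Q₀)`,
bounded term by term. [folklore] -/
theorem abs_replace_le (χ₁ χ₀ ψ P P₀ Q Q₀ : ℝ) :
    |χ₁ * ψ * P - χ₁ * Q - χ₀ * (ψ * P₀ - Q₀)| ≤
      |χ₁| * (|ψ| * |P - P₀| + |Q - Q₀|) + |χ₁ - χ₀| * (|ψ| * |P₀| + |Q₀|) := by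
  have h : χ₁ * ψ * P - χ₁ * Q - χ₀ * (ψ * P₀ - Q₀) =
      χ₁ * (ψ * (P - P₀)) - χ₁ * (Q - Q₀) + (χ₁ - χ₀) * (ψ * P₀ - Q₀) := by ring
  rw [h]
  have h1 : |χ₁ * (ψ * (P - P₀)) - χ₁ * (Q - Q₀)| ≤ |χ₁| * (|ψ| * |P - P₀| + |Q - Q₀|) := by
    refine (abs_sub _ _).trans (le_of_eq ?_)
    rw [abs_mul, abs_mul, abs_mul, mul_add]
  have h2 : |(χ₁ - χ₀) * (ψ * P₀ - Q₀)| ≤ |χ₁ - χ₀| * (|ψ| * |P₀| + |Q₀|) := by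
    rw [abs_mul]
    refine mul_le_mul_of_nonneg_left ((abs_sub _ _).trans (le_of_eq ?_)) (abs_nonneg _)
    rw [abs_mul]
  exact (abs_add_le _ _).trans (add_le_add h1 h2)

section Replace

variable {σ : ℝ} {N : ℕ} (Φ : Flow σ N) {z : Phase N}

/-- `√3 / 2 ≤ 1`. [folklore] -/
theorem sqrt_three_div_two_le_one : Real.sqrt 3 / 2 ≤ 1 := by
  have h3 : Real.sqrt 3 ^ 2 = 3 := Real.sq_sqrt (by norm_num)
  have h0 : 0 ≤ Real.sqrt 3 := Real.sqrt_nonneg _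
  nlinarith

/-- **The per-collision replacement inequality.** For a collision triple `e = (s, i, j)` of step `k` on a good orbit, with `χ` bounded by `Cχ` and
`(ρ, ϖ)`-uniformly continuous on `[0, S] × 𝕋³` (`(k+1)Δ ≤ S`, `Δ < ϖ/2`), `|Ψ| ≤ CΨ`, and the two mollified pair fields of
the orbit bounded by `S₁, S_Ψ` and jointly Lipschitz with constants `(Kt, Kx)`: the target's summand differs from its frozen
value by at most `α + β · stepPath i`,
`α = Cχ(CΨKt₁ + KtΨ)Δ + Cχ(CΨKx₁ + KxΨ)(√3/2)Δ + ρ(CΨS₁ + S_Ψ)`, `β = Cχ(CΨKx₁ + KxΨ) + (4Cχ/ϖ)(CΨS₁ + S_Ψ)`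
(a first member displaced by more than `ϖ/2` in the step is charged `2Cχ ≤ (4Cχ/ϖ) stepPath`). [folklore] -/
theorem abs_dockSummand_sub_dockMain_le (hz : z ∈ Φ.good) {c : ℝ} (hc : 0 < c) (hσ : 0 < σ)
    (χ : ℝ × T3 → ℝ) (Ψ : V3 × V3 × V3 → ℝ) (r τ : ℝ) {k : ℕ} {e : ℝ × Fin (N + 1) × Fin (N + 1)}
    (he : e ∈ collTriples Φ (stepWindow c σ N k) z)
    {S Cχ ρ ϖ CΨ S₁ Kt₁ Kx₁ SΨ KtΨ KxΨ : ℝ} (hkS : ((k : ℝ) + 1) * stepLen c σ N ≤ S)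
    (hχ : ∀ p : ℝ × T3, p.1 ∈ Icc 0 S → |χ p| ≤ Cχ)
    (hχuc : ∀ p p' : ℝ × T3, p.1 ∈ Icc 0 S → p'.1 ∈ Icc 0 S → |p.1 - p'.1| < ϖ →
      Torus.euclidDist p.2 p'.2 < ϖ → |χ p - χ p'| ≤ ρ)
    (hϖ : 0 < ϖ) (hΔϖ : stepLen c σ N < ϖ / 2) (hΨ : ∀ p, |Ψ p| ≤ CΨ)
    (hS1 : ∀ s x, |targetPm (fun _ => 1) r τ σ N Φ z s x| ≤ S₁)
    (hL1 : ∀ s x s' x', |targetPm (fun _ => 1) r τ σ N Φ z s x - targetPm (fun _ => 1) r τ σ N Φ z s' x'| ≤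
      Kt₁ * |s - s'| + Kx₁ * Torus.euclidDist x x')
    (hSΨ : ∀ s x, |targetPm Ψ r τ σ N Φ z s x| ≤ SΨ)
    (hLΨ : ∀ s x s' x', |targetPm Ψ r τ σ N Φ z s x - targetPm Ψ r τ σ N Φ z s' x'| ≤
      KtΨ * |s - s'| + KxΨ * Torus.euclidDist x x')
    (hKt₁ : 0 ≤ Kt₁) (hKx₁ : 0 ≤ Kx₁) (hKtΨ : 0 ≤ KtΨ) (hKxΨ : 0 ≤ KxΨ) :
    |dockSummand χ Ψ r τ σ N Φ z e.1 (Φ.flow e.1 z) e.2.1 e.2.2 - dockMain χ Ψ r τ c σ N Φ k z e| ≤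
      Cχ * (CΨ * Kt₁ + KtΨ) * stepLen c σ N + Cχ * (CΨ * Kx₁ + KxΨ) * (Real.sqrt 3 / 2 * stepLen c σ N) +
          ρ * (CΨ * S₁ + SΨ) +
        (Cχ * (CΨ * Kx₁ + KxΨ) + 4 * Cχ / ϖ * (CΨ * S₁ + SΨ)) * stepPath c σ N Φ k z e.2.1 := by
  set Δ := stepLen c σ N with hΔdef
  set s := e.1 with hsdef
  set i := e.2.1 with hidef
  set x : T3 := (Φ.flow s z i).1 with hxdef
  set s₀ : ℝ := (k : ℝ) * Δ with hs₀def
  set x₀ : T3 := cellCentre c σ N (startCell c σ N Φ k z i) with hx₀def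
  set L := stepPath c σ N Φ k z i with hLdef
  set χ₁ := χ (s, x); set χ₀ := χ (s₀, x₀); set ψ := Ψ (markOf N (hsDiameter σ N) (Φ.flow s z) i e.2.2)
  set P := targetPm (fun _ => 1) r τ σ N Φ z s x; set P₀ := targetPm (fun _ => 1) r τ σ N Φ z s₀ x₀
  set Q := targetPm Ψ r τ σ N Φ z s x; set Q₀ := targetPm Ψ r τ σ N Φ z s₀ x₀
  have hΔ : 0 < Δ := stepLen_pos hc hσ N
  obtain ⟨hs1, hs2⟩ := time_mem_of_mem_collTriples Φ hz he
  have hk0 : 0 ≤ s₀ := mul_nonneg (Nat.cast_nonneg k) hΔ.le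
  have hs₀S : s₀ ∈ Icc 0 S := ⟨hk0, by rw [hs₀def]; nlinarith⟩
  have hsS : s ∈ Icc 0 S := ⟨hk0.trans hs1.le, hs2.trans hkS⟩
  have hds : |s - s₀| ≤ Δ := abs_time_sub_le_of_mem_collTriples Φ hz he
  have hL0 : 0 ≤ L := stepPath_nonneg hΔ.le Φ k z i
  have hdx : Torus.euclidDist x x₀ ≤ L + Real.sqrt 3 / 2 * Δ := euclidDist_cellCentre_startCell_le Φ hz hc hσ he
  have hD0 : 0 ≤ Torus.euclidDist x x₀ := by rw [Torus.euclidDist_eq]; exact norm_nonneg _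
  -- nonnegativity of the constants
  have hCχ : 0 ≤ Cχ := (abs_nonneg _).trans (hχ (s₀, x₀) hs₀S)
  have hCΨ : 0 ≤ CΨ := (abs_nonneg _).trans (hΨ 0)
  have hS1' : 0 ≤ S₁ := (abs_nonneg _).trans (hS1 s₀ x₀)
  have hSΨ' : 0 ≤ SΨ := (abs_nonneg _).trans (hSΨ s₀ x₀)
  have hρ : 0 ≤ ρ := by
    have h := hχuc (s₀, x₀) (s₀, x₀) hs₀S hs₀S (by simp [hϖ]) (by rw [Torus.euclidDist_self]; exact hϖ)
    rwa [sub_self, abs_zero] at h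
  have hCP : 0 ≤ CΨ * S₁ + SΨ := by positivity
  -- the elementary bounds
  have hχ₁ : |χ₁| ≤ Cχ := hχ (s, x) hsS
  have hψ : |ψ| ≤ CΨ := hΨ _
  have hP : |P - P₀| ≤ Kt₁ * Δ + Kx₁ * (L + Real.sqrt 3 / 2 * Δ) :=
    (hL1 s x s₀ x₀).trans (add_le_add (mul_le_mul_of_nonneg_left hds hKt₁) (mul_le_mul_of_nonneg_left hdx hKx₁))
  have hQ : |Q - Q₀| ≤ KtΨ * Δ + KxΨ * (L + Real.sqrt 3 / 2 * Δ) :=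
    (hLΨ s x s₀ x₀).trans (add_le_add (mul_le_mul_of_nonneg_left hds hKtΨ) (mul_le_mul_of_nonneg_left hdx hKxΨ))
  have hP₀ : |P₀| ≤ S₁ := hS1 s₀ x₀
  have hQ₀ : |Q₀| ≤ SΨ := hSΨ s₀ x₀
  -- the modulus of the localiser, far-displaced first members charged to their path length
  have hχd : |χ₁ - χ₀| ≤ ρ + 4 * Cχ / ϖ * L := by
    rcases le_or_gt L (ϖ / 2) with hLϖ | hLϖ
    · have h1 : |s - s₀| < ϖ := hds.trans_lt (by linarith)
      have h2 : Torus.euclidDist x x₀ < ϖ := by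
        have h32 := sqrt_three_div_two_le_one
        have : Real.sqrt 3 / 2 * Δ ≤ Δ := by nlinarith
        linarith
      have h := hχuc (s, x) (s₀, x₀) hsS hs₀S h1 h2
      have : 0 ≤ 4 * Cχ / ϖ * L := by positivity
      linarith
    · have h1 : |χ₁ - χ₀| ≤ 2 * Cχ := by
        have := hχ (s₀, x₀) hs₀S
        calc |χ₁ - χ₀| ≤ |χ₁| + |χ₀| := abs_sub _ _
          _ ≤ Cχ + Cχ := add_le_add hχ₁ this
          _ = 2 * Cχ := by ring
      have h2 : 2 * Cχ ≤ 4 * Cχ / ϖ * L := by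
        rw [div_mul_eq_mul_div, le_div_iff₀ hϖ]
        nlinarith
      linarith
  -- assemble
  have hmain := abs_replace_le χ₁ χ₀ ψ P P₀ Q Q₀
  have hds_eq : dockSummand χ Ψ r τ σ N Φ z e.1 (Φ.flow e.1 z) e.2.1 e.2.2 = χ₁ * ψ * P - χ₁ * Q := rfl
  have hdm_eq : dockMain χ Ψ r τ c σ N Φ k z e = χ₀ * (ψ * P₀ - Q₀) := rfl
  rw [hds_eq, hdm_eq]
  have hT1 : |χ₁| * (|ψ| * |P - P₀| + |Q - Q₀|) ≤
      Cχ * (CΨ * (Kt₁ * Δ + Kx₁ * (L + Real.sqrt 3 / 2 * Δ)) + (KtΨ * Δ + KxΨ * (L + Real.sqrt 3 / 2 * Δ))) := by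
    refine mul_le_mul hχ₁ (add_le_add (mul_le_mul hψ hP (abs_nonneg _) hCΨ) hQ) (by positivity) hCχ
  have hT2 : |χ₁ - χ₀| * (|ψ| * |P₀| + |Q₀|) ≤ (ρ + 4 * Cχ / ϖ * L) * (CΨ * S₁ + SΨ) := by
    refine mul_le_mul hχd (add_le_add (mul_le_mul hψ hP₀ (abs_nonneg _) hCΨ) hQ₀) (by positivity) ?_
    positivity
  refine (hmain.trans (add_le_add hT1 hT2)).trans (le_of_eq ?_)
  ring

/-- **Crude bound of the target's summand**: `|dockSummand| ≤ Cχ (CΨ S₁ + S_Ψ)` for a triple of step `k`. [folklore] -/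
theorem abs_dockSummand_le (hz : z ∈ Φ.good) {c : ℝ} (hc : 0 < c) (hσ : 0 < σ)
    (χ : ℝ × T3 → ℝ) (Ψ : V3 × V3 × V3 → ℝ) (r τ : ℝ) {k : ℕ} {e : ℝ × Fin (N + 1) × Fin (N + 1)}
    (he : e ∈ collTriples Φ (stepWindow c σ N k) z) {S Cχ CΨ S₁ SΨ : ℝ} (hkS : ((k : ℝ) + 1) * stepLen c σ N ≤ S)
    (hχ : ∀ p : ℝ × T3, p.1 ∈ Icc 0 S → |χ p| ≤ Cχ) (hΨ : ∀ p, |Ψ p| ≤ CΨ)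
    (hS1 : ∀ s x, |targetPm (fun _ => 1) r τ σ N Φ z s x| ≤ S₁) (hSΨ : ∀ s x, |targetPm Ψ r τ σ N Φ z s x| ≤ SΨ) :
    |dockSummand χ Ψ r τ σ N Φ z e.1 (Φ.flow e.1 z) e.2.1 e.2.2| ≤ Cχ * (CΨ * S₁ + SΨ) := by
  have hΔ : 0 < stepLen c σ N := stepLen_pos hc hσ N
  obtain ⟨hs1, hs2⟩ := time_mem_of_mem_collTriples Φ hz he
  have hk0 : 0 ≤ (k : ℝ) * stepLen c σ N := mul_nonneg (Nat.cast_nonneg k) hΔ.le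
  have hsS : e.1 ∈ Icc 0 S := ⟨hk0.trans hs1.le, hs2.trans hkS⟩
  have hCΨ : 0 ≤ CΨ := (abs_nonneg _).trans (hΨ 0)
  have hCχ : 0 ≤ Cχ := (abs_nonneg _).trans (hχ (e.1, (Φ.flow e.1 z e.2.1).1) hsS)
  have hds_eq : dockSummand χ Ψ r τ σ N Φ z e.1 (Φ.flow e.1 z) e.2.1 e.2.2 =
      χ (e.1, (Φ.flow e.1 z e.2.1).1) * (Ψ (markOf N (hsDiameter σ N) (Φ.flow e.1 z) e.2.1 e.2.2) *
        targetPm (fun _ => 1) r τ σ N Φ z e.1 (Φ.flow e.1 z e.2.1).1 - targetPm Ψ r τ σ N Φ z e.1 (Φ.flow e.1 z e.2.1).1) := by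
    unfold dockSummand; ring
  rw [hds_eq, abs_mul]
  refine mul_le_mul (hχ _ hsS) ((abs_sub _ _).trans (add_le_add ?_ (hSΨ _ _))) (abs_nonneg _) hCχ
  rw [abs_mul]
  exact mul_le_mul (hΨ _) (hS1 _ _) (abs_nonneg _) hCΨ

/-- **Crude bound of the frozen main term**: `|dockMain| ≤ Cχ (CΨ S₁ + S_Ψ)` for a triple of step `k`. [folklore] -/
theorem abs_dockMain_le {c : ℝ} (hc : 0 < c) (hσ : 0 < σ)
    (χ : ℝ × T3 → ℝ) (Ψ : V3 × V3 × V3 → ℝ) (r τ : ℝ) (k : ℕ) (z : Phase N) (e : ℝ × Fin (N + 1) × Fin (N + 1))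
    {S Cχ CΨ S₁ SΨ : ℝ} (hkS : ((k : ℝ) + 1) * stepLen c σ N ≤ S)
    (hχ : ∀ p : ℝ × T3, p.1 ∈ Icc 0 S → |χ p| ≤ Cχ) (hΨ : ∀ p, |Ψ p| ≤ CΨ)
    (hS1 : ∀ s x, |targetPm (fun _ => 1) r τ σ N Φ z s x| ≤ S₁) (hSΨ : ∀ s x, |targetPm Ψ r τ σ N Φ z s x| ≤ SΨ) :
    |dockMain χ Ψ r τ c σ N Φ k z e| ≤ Cχ * (CΨ * S₁ + SΨ) := by
  have hΔ : 0 < stepLen c σ N := stepLen_pos hc hσ N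
  have hk0 : 0 ≤ (k : ℝ) * stepLen c σ N := mul_nonneg (Nat.cast_nonneg k) hΔ.le
  have hsS : (k : ℝ) * stepLen c σ N ∈ Icc 0 S := ⟨hk0, by nlinarith⟩
  have hCΨ : 0 ≤ CΨ := (abs_nonneg _).trans (hΨ 0)
  have hCχ : 0 ≤ Cχ := (abs_nonneg _).trans (hχ ((k : ℝ) * stepLen c σ N, cellCentre c σ N 0) hsS)
  unfold dockMain
  rw [abs_mul]
  refine mul_le_mul (hχ _ hsS) ((abs_sub _ _).trans (add_le_add ?_ (hSΨ _ _))) (abs_nonneg _) hCχ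
  rw [abs_mul]
  exact mul_le_mul (hΨ _) (hS1 _ _) (abs_nonneg _) hCΨ

end Replace

/-! ## The frozen terms of a step regrouped by start cell -/

section Main

variable {σ : ℝ} {N : ℕ} (Φ : Flow σ N) {z : Phase N}

/-- **Registered helper `sum_dockMain_eq` (piece B of the docking S7): the frozen main terms of a step regroup by start
cell**: `Σ_{triples of step k} dockMain = (n̄c) Σ_{q ∈ box} χ(kΔ, centre q) Σ_{q' ∈ box} [A_r(kΔ, centre q) collPair Ψ (q,q') −
B^Ψ_r(kΔ, centre q) collPair 1 (q,q')]`. [folklore] -/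
theorem sum_dockMain_eq : ∀ {σ : ℝ} {N : ℕ} (Φ : Flow σ N) {z : Phase N}, z ∈ Φ.good → ∀ (χ : ℝ × T3 → ℝ) (Ψ : V3 × V3 × V3 → ℝ) (r τ : ℝ) {c : ℝ}, 0 < c → 0 < σ → ∀ k : ℕ, ∑ e ∈ collTriples Φ (stepWindow c σ N k) z, dockMain χ Ψ r τ c σ N Φ k z e = (cellCount c σ N * c) * ∑ q ∈ cellBox (c * meanFreePath σ N), χ ((k : ℝ) * stepLen c σ N, cellCentre c σ N q) * ∑ q' ∈ cellBox (c * meanFreePath σ N), (targetPm (fun _ => 1) r τ σ N Φ z ((k : ℝ) * stepLen c σ N) (cellCentre c σ N q) * collPair Ψ c σ N Φ k q q' z - targetPm Ψ r τ σ N Φ z ((k : ℝ) * stepLen c σ N) (cellCentre c σ N q) * collPair (fun _ => 1) c σ N Φ k q q' z) := by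
  intro σ N Φ z hz χ Ψ r τ c hc hσ k
  set B := cellBox (c * meanFreePath σ N); set T := collTriples Φ (stepWindow c σ N k) z
  set s₀ : ℝ := (k : ℝ) * stepLen c σ N
  have hpos : 0 < cellCount c σ N * c := mul_pos (cellCount_pos hc hσ N) hc
  have hh : 0 < c * meanFreePath σ N := mul_pos hc (meanFreePath_pos hσ N)
  -- the sums over the partner cell are sums over the triples of the step
  have hrow : ∀ (Ξ : V3 × V3 × V3 → ℝ) (q : Cell),
      ∑ q' ∈ B, collPair Ξ c σ N Φ k q q' z = (cellCount c σ N * c)⁻¹ *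
        ∑ e ∈ T, (if startCell c σ N Φ k z e.2.1 = q then Ξ (markOf N (hsDiameter σ N) (Φ.flow e.1 z) e.2.1 e.2.2) else 0) :=
    fun Ξ q => sum_collPair_eq Φ hz Ξ hc hσ k q
  -- insert the start cell of the first member as a summation variable
  have hlhs : ∑ e ∈ T, dockMain χ Ψ r τ c σ N Φ k z e = ∑ e ∈ T, ∑ q ∈ B,
      (if startCell c σ N Φ k z e.2.1 = q then
        χ (s₀, cellCentre c σ N q) * (Ψ (markOf N (hsDiameter σ N) (Φ.flow e.1 z) e.2.1 e.2.2) *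
          targetPm (fun _ => 1) r τ σ N Φ z s₀ (cellCentre c σ N q) - targetPm Ψ r τ σ N Φ z s₀ (cellCentre c σ N q))
        else 0) := by
    refine Finset.sum_congr rfl fun e _ => ?_
    rw [Finset.sum_ite_eq B (startCell c σ N Φ k z e.2.1), if_pos (startCell_mem_cellBox hh Φ k z e.2.1)]
    rfl
  rw [hlhs, Finset.sum_comm, Finset.mul_sum]
  refine Finset.sum_congr rfl fun q _ => ?_
  have hsplit : ∀ e ∈ T, (if startCell c σ N Φ k z e.2.1 = q then
        χ (s₀, cellCentre c σ N q) * (Ψ (markOf N (hsDiameter σ N) (Φ.flow e.1 z) e.2.1 e.2.2) *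
          targetPm (fun _ => 1) r τ σ N Φ z s₀ (cellCentre c σ N q) - targetPm Ψ r τ σ N Φ z s₀ (cellCentre c σ N q))
        else 0) =
      χ (s₀, cellCentre c σ N q) * (targetPm (fun _ => 1) r τ σ N Φ z s₀ (cellCentre c σ N q) *
          (if startCell c σ N Φ k z e.2.1 = q then Ψ (markOf N (hsDiameter σ N) (Φ.flow e.1 z) e.2.1 e.2.2) else 0) -
        targetPm Ψ r τ σ N Φ z s₀ (cellCentre c σ N q) *
          (if startCell c σ N Φ k z e.2.1 = q then (fun _ : V3 × V3 × V3 => (1 : ℝ))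
            (markOf N (hsDiameter σ N) (Φ.flow e.1 z) e.2.1 e.2.2) else 0)) := by
    intro e _
    split_ifs <;> ring
  rw [Finset.sum_congr rfl hsplit, ← Finset.mul_sum, Finset.sum_sub_distrib, ← Finset.mul_sum, ← Finset.mul_sum]
  have h1 : ∑ e ∈ T, (if startCell c σ N Φ k z e.2.1 = q then Ψ (markOf N (hsDiameter σ N) (Φ.flow e.1 z) e.2.1 e.2.2)
      else 0) = (cellCount c σ N * c) * ∑ q' ∈ B, collPair Ψ c σ N Φ k q q' z := by
    rw [hrow, ← mul_assoc, mul_inv_cancel₀ hpos.ne', one_mul]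
  have h2 : ∑ e ∈ T, (if startCell c σ N Φ k z e.2.1 = q then (fun _ : V3 × V3 × V3 => (1 : ℝ))
      (markOf N (hsDiameter σ N) (Φ.flow e.1 z) e.2.1 e.2.2) else 0) =
      (cellCount c σ N * c) * ∑ q' ∈ B, collPair (fun _ => 1) c σ N Φ k q q' z := by
    rw [hrow, ← mul_assoc, mul_inv_cancel₀ hpos.ne', one_mul]
  rw [h1, h2, Finset.sum_sub_distrib, ← Finset.mul_sum, ← Finset.mul_sum]
  ring

/-- `collPair 1 · relDefect Ψ = collPair Ψ − collPair 1 · (pairPair Ψ / pairPair 1)` (no junk: a cell pair without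
collisions has `collPair Ψ = 0`). [folklore] -/
theorem collPair_mul_relDefect (hz : z ∈ Φ.good) {Ψ : V3 × V3 × V3 → ℝ} {C : ℝ} (hC : ∀ p, |Ψ p| ≤ C) {c : ℝ}
    (hc : 0 < c) (hσ : 0 < σ) (k : ℕ) (q q' : Cell) :
    collPair (fun _ => 1) c σ N Φ k q q' z * relDefect Ψ c σ N Φ k q q' z =
      collPair Ψ c σ N Φ k q q' z -
        collPair (fun _ => 1) c σ N Φ k q q' z * (pairPair Ψ c σ N Φ k q q' z / pairPair (fun _ => 1) c σ N Φ k q q' z) := by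
  unfold relDefect
  by_cases h0 : collPair (fun _ => 1) c σ N Φ k q q' z = 0
  · have hΨ0 : collPair Ψ c σ N Φ k q q' z = 0 := by
      have h := abs_collPair_le Φ hz hC hc hσ k q q'
      rw [h0, mul_zero] at h
      exact abs_eq_zero.1 (le_antisymm h (abs_nonneg _))
    rw [h0, hΨ0]; ring
  · rw [mul_sub, mul_div_cancel₀ _ h0]

/-- **The frozen cell sum of a step against the mesoscopic-oscillation integrand and the cross-ratio defect**:
`|Σ_q χ_q Σ_{q'} [A_r collPair Ψ − B^Ψ_r collPair 1]| ≤ Cχ Σ_q Σ'_{q'} collPair 1 |A_r (pairPair Ψ/pairPair 1) − B^Ψ_r|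
+ Cχ S₁ Σ_q Σ_{q'} collPair 1 |relDefect Ψ|` (all fields read at `(kΔ, centre q)`). [folklore] -/
theorem abs_stepMain_le (hz : z ∈ Φ.good) (χ : ℝ × T3 → ℝ) {Ψ : V3 × V3 × V3 → ℝ} {CΨ : ℝ} (hΨ : ∀ p, |Ψ p| ≤ CΨ)
    (r τ : ℝ) {c : ℝ} (hc : 0 < c) (hσ : 0 < σ) (k : ℕ) {Cχ S₁ : ℝ}
    (hχ : ∀ q ∈ cellBox (c * meanFreePath σ N), |χ ((k : ℝ) * stepLen c σ N, cellCentre c σ N q)| ≤ Cχ)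
    (hS1 : ∀ x, |targetPm (fun _ => 1) r τ σ N Φ z ((k : ℝ) * stepLen c σ N) x| ≤ S₁) :
    |∑ q ∈ cellBox (c * meanFreePath σ N), χ ((k : ℝ) * stepLen c σ N, cellCentre c σ N q) *
        ∑ q' ∈ cellBox (c * meanFreePath σ N),
          (targetPm (fun _ => 1) r τ σ N Φ z ((k : ℝ) * stepLen c σ N) (cellCentre c σ N q) * collPair Ψ c σ N Φ k q q' z -
            targetPm Ψ r τ σ N Φ z ((k : ℝ) * stepLen c σ N) (cellCentre c σ N q) * collPair (fun _ => 1) c σ N Φ k q q' z)| ≤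
      Cχ * ∑ q ∈ cellBox (c * meanFreePath σ N), (∑' q' : Cell, collPair (fun _ => 1) c σ N Φ k q q' z *
          |targetPm (fun _ => 1) r τ σ N Φ z ((k : ℝ) * stepLen c σ N) (cellCentre c σ N q) *
              (pairPair Ψ c σ N Φ k q q' z / pairPair (fun _ => 1) c σ N Φ k q q' z) -
            targetPm Ψ r τ σ N Φ z ((k : ℝ) * stepLen c σ N) (cellCentre c σ N q)|) +
        Cχ * S₁ * ∑ q ∈ cellBox (c * meanFreePath σ N), ∑ q' ∈ cellBox (c * meanFreePath σ N),
          collPair (fun _ => 1) c σ N Φ k q q' z * |relDefect Ψ c σ N Φ k q q' z| := by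
  set B := cellBox (c * meanFreePath σ N); set s₀ : ℝ := (k : ℝ) * stepLen c σ N
  have hh : 0 < c * meanFreePath σ N := mul_pos hc (meanFreePath_pos hσ N)
  -- the `tsum` over the partner cell is the box sum
  have htsum : ∀ q : Cell, (∑' q' : Cell, collPair (fun _ => 1) c σ N Φ k q q' z *
      |targetPm (fun _ => 1) r τ σ N Φ z s₀ (cellCentre c σ N q) *
          (pairPair Ψ c σ N Φ k q q' z / pairPair (fun _ => 1) c σ N Φ k q q' z) -
        targetPm Ψ r τ σ N Φ z s₀ (cellCentre c σ N q)|) =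
      ∑ q' ∈ B, collPair (fun _ => 1) c σ N Φ k q q' z *
        |targetPm (fun _ => 1) r τ σ N Φ z s₀ (cellCentre c σ N q) *
            (pairPair Ψ c σ N Φ k q q' z / pairPair (fun _ => 1) c σ N Φ k q q' z) -
          targetPm Ψ r τ σ N Φ z s₀ (cellCentre c σ N q)| := fun q =>
    tsum_cell_eq_sum fun q' hq' => by rw [collPair_eq_zero_of_not_mem hh _ Φ k (Or.inr hq') z, zero_mul]
  simp_rw [htsum]
  rw [Finset.mul_sum, Finset.mul_sum, ← Finset.sum_add_distrib]
  refine (Finset.abs_sum_le_sum_abs _ _).trans (Finset.sum_le_sum fun q hq => ?_)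
  rw [abs_mul, Finset.mul_sum, Finset.mul_sum, ← Finset.sum_add_distrib]
  have hCχ : 0 ≤ Cχ := (abs_nonneg _).trans (hχ q hq)
  refine (mul_le_mul (hχ q hq) (Finset.abs_sum_le_sum_abs _ _) (abs_nonneg _) hCχ).trans ?_
  rw [Finset.mul_sum]
  refine Finset.sum_le_sum fun q' _ => ?_
  -- per cell pair: `A cPΨ − B cP1 = A (cPΨ − cP1 ρ) + cP1 (A ρ − B)`, `|cPΨ − cP1 ρ| = cP1 |relDefect|`
  set A := targetPm (fun _ => 1) r τ σ N Φ z s₀ (cellCentre c σ N q); set Bq := targetPm Ψ r τ σ N Φ z s₀ (cellCentre c σ N q)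
  set cP1 := collPair (fun _ => 1) c σ N Φ k q q' z; set cPΨ := collPair Ψ c σ N Φ k q q' z
  set ρ := pairPair Ψ c σ N Φ k q q' z / pairPair (fun _ => 1) c σ N Φ k q q' z
  have hcP1_0 : 0 ≤ cP1 := collPair_one_nonneg hc.le hσ Φ k q q' z
  have hkey : cPΨ - cP1 * ρ = cP1 * relDefect Ψ c σ N Φ k q q' z := (collPair_mul_relDefect Φ hz hΨ hc hσ k q q').symm
  have hsplit : A * cPΨ - Bq * cP1 = A * (cPΨ - cP1 * ρ) + cP1 * (A * ρ - Bq) := by ring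
  rw [hsplit, hkey]
  calc Cχ * |A * (cP1 * relDefect Ψ c σ N Φ k q q' z) + cP1 * (A * ρ - Bq)|
      ≤ Cχ * (|A| * (cP1 * |relDefect Ψ c σ N Φ k q q' z|) + cP1 * |A * ρ - Bq|) := by
        refine mul_le_mul_of_nonneg_left ((abs_add_le _ _).trans (le_of_eq ?_)) hCχ
        rw [abs_mul, abs_mul, abs_mul, abs_of_nonneg hcP1_0]
    _ ≤ Cχ * (S₁ * (cP1 * |relDefect Ψ c σ N Φ k q q' z|) + cP1 * |A * ρ - Bq|) := by
        gcongr
        exact hS1 _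
    _ = Cχ * (cP1 * |A * ρ - Bq|) + Cχ * S₁ * (cP1 * |relDefect Ψ c σ N Φ k q q' z|) := by ring

end Main

end Summit.AtomisticToContinuum.HydrodynamicLimit.Theorems.EquilibriumForecastLine

end
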